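import Literature.Algebra.Lie.LefschetzModuleHorizontalSubalgebra
import HarnessLib

/-!
# Looijenga–Lunts (5.3), third paragraph: `𝔞_{0,2}`, `𝔤(𝔞_{0,2}, M_ver) ⊂ 𝔤(𝔞, M)_{0,•}` and the injective homomorphism `𝔤(𝔞_{2,0}, M_hor) × 𝔤(𝔞_{0,2}, M_ver) → 𝔤(𝔞, M)`

Topic `Literature/Algebra/Lie` (namespace `Literature.Algebra.Lie`).  Lane `lit-hodgefound` (Track 2 foundations
library), skeleton seat `lit-hodgefound-skel-1` (generation 47), row **A1-150** of
`run/shared/lean/pub/lit-hodgefound/SKELETON.md`.  Sequel of A1-149 (`LefschetzModuleHorizontalSubalgebra.lean`: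
`degreeComponent`, `𝔞_hor = horizontalPart`, `𝔞_{2,0} = horizontalTwoZero`, `𝔤(𝔞_{2,0}, M_hor) ⊂ 𝔤(𝔞, M)_{•,0}`): the
THIRD PARAGRAPH of the Proposition of (5.3) and its proof — the vertical counterpart `𝔞_{0,2}`, the vertical Lie
algebra `𝔤(𝔞_{0,2}, M_ver)`, the commutation of the horizontal and vertical Lie algebras inside `𝔤(𝔞, M)`, their
trivial intersection, and the injective homomorphism from their product.  DEFINITIONS WITH BODIES (`verticalPart`,
`verticalZeroTwo`) and PROVED theorems only (no named fact, no `sorry`, no instance, no notation; D-0026 net debt `0`).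
The commutator Lie ring of `𝔤𝔩(M) = Module.End K M` is Mathlib's reducible non-instance `LieRing.ofAssociativeRing`,
enabled FILE-LOCALLY as in every `End`-form file of the series.

## Source, VERBATIM

E. Looijenga, V. A. Lunts, *A Lie algebra attached to a projective variety*, Invent. Math. **129** (1997) 361–412
(held TeX text `paper:arxiv-alg-geom_9604014`, page/line numbers of that text), §5 (5.3), p0021:

> (L1–L6) "Let `(𝔞, M)` be a Lefschetz module and `hor^• M` a nonincreasing filtration on the graded vector space
> underlying `M` (so `hor^k M = ⊕_l hor^k M_l`) which is preserved by `𝔞`. […] Then the associated vertical filtration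
> is defined by `ver_k M := Σ_r hor^{r-k} M_r`. This filtration is nondecreasing; we call the corresponding grading of
> `Gr_ver M` the vertical grading."
> (Proposition, third paragraph, L45–L52) "If in addition, `Gr^ver M` is a Lefschetz module of `𝔞`, then the span of
> the components of `𝔞` of highest vertical degree `2` make up an abelian subalgebra `𝔞_{0,2}` of `𝔤(𝔞, M)_{0,2}` that
> has the Lefschetz property in `M` with respect to the vertical grading. Moreover, `𝔤(𝔞_{0,2}, M_ver)` is a
> subalgebra of `𝔤(𝔞, M)_{0,•}` that maps isomorphically onto `𝔤(𝔞, Gr^ver M)`. The obvious map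
> `𝔤(𝔞_{2,0}, M_hor) × 𝔤(𝔞_{0,2}, M_ver) → 𝔤(𝔞, M)` is then an injective homomorphism of Lie algebra's."
> (Proof, L54–L72) "Everything follows from the preceding or is obvious except the very last statement. We claim that
> any 'horizontal' `𝔰𝔩₂`-triple `(e', h', e')` acting in `Gr M` commutes with any 'vertical' `𝔰𝔩₂`-triple
> `(e'', h'', e'')` acting in `Gr M`. This just follows from the fact that `(e', h')` commutes with `(e'', h'')` and
> the fact that in either case the last member is a rational expression in the first two. It follows that
> `𝔤(𝔞_hor, Gr_hor M)` and `𝔤(𝔞, Gr^ver M)` commute. The same is therefore true for their bigraded lifts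
> `𝔤(𝔞_{2,0}, M)` and `𝔤(𝔞_{0,2}, M)` in `𝔤(𝔞, M)`. To see that `𝔤(𝔞_{2,0}, M) ∩ 𝔤(𝔞_{0,2}, M) = 0`, note that this
> intersection has bidegree `(0,0)` and is normal in either of them. If it were nonzero, then it would contain a
> simple factor of `𝔤(𝔞_{2,0}, M)` of bidegree `(0,0)`. But this is impossible since `𝔤(𝔞_{2,0}, M)` is (as a Lie
> algebra) generated by its degree `±2` summands. The proposition follows."

## Rendering (dictionary; the MODEL of A1-148/A1-149)

* `h_hor = H ∈ 𝔤(𝔞, M)`, `ℤ`-diagonalisable, of total degree `0` (`H ∈ adDegree K h 0`); `h_ver = h - H`; `hor^k M =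
  ⨆_{j ≥ k} M_j(H)`, `ver_k M = ⨆_{m ≤ k} M_m(h - H)` (A1-148 `verFiltration_eq`); `Gr^ver M` identified with `M` graded
  by `h_ver` (A1-148's bigrading `M_{k,l}`).
* "preserved by `𝔞`": in the model the horizontal filtration of `H` need not be stable under all of `𝔞`, so the
  operative subspace is **`𝔞_ver = verticalPart H 𝔞 := {a ∈ 𝔞 | a hor^k M ⊆ hor^k M}`** (`= 𝔞` under the printed
  standing hypothesis, `verticalPart_eq_of_forall`); such `a` (total degree `2`) decompose as `a = Σ_{j ≥ 0} a_{j, 2-j}`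
  (`mem_verticalPart_iff_mem_biSup`, `degreeComponent_ad_mem_adDegree_sub`), raise `ver` by at most `2`
  (`apply_mem_verFiltration_of_mem_verticalPart`) and act on `Gr^ver M` through the component `a_0 = a_{0,2}` of
  "highest vertical degree `2`".
* `𝔞_{0,2} = verticalZeroTwo H 𝔞 := 𝔞_ver.map (a ↦ a_0)`; `𝔤(𝔞_{0,2}, M_ver) = lefschetzLieAlgebra K (h - H) 𝔞_{0,2}`
  (A1-88's `𝔤(𝔞', ·)` for the VERTICAL grading operator `h_ver`); `𝔤(𝔞_{2,0}, M_hor) = lefschetzLieAlgebra K H 𝔞_{2,0}`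
  (A1-149); the product Lie algebra is Mathlib's `LieAlgebra.Prod`.

## Contents (all proved; `K` a field of characteristic `0`, `M` finite-dimensional)

* §1 **`degreeComponent_ad_lie_eq`** (`[a, b]_{c+d} = [a_c, b_d]` for `a ∈ ⊕_{≥c}`, `b ∈ ⊕_{≥d}` — the lowest component of
  a bracket), `forall_apply_mem_horFiltration_add_iff` (raising `hor` by `c` ⟺ `∈ ⊕_{j ≥ c} 𝔤𝔩(M)_j(ad H)`, general
  `c`), **`verticalPart H 𝔞 = 𝔞_ver`** (`mem_verticalPart_iff`, `verticalPart_le`, `verticalPart_eq_of_forall`,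
  `horizontalPart_le_verticalPart`, `mem_verticalPart_iff_mem_biSup`), `degreeComponent_ad_mem_adDegree_sub` (`a_j` has
  bidegree `(j, 2-j)`), **`apply_mem_verFiltration_of_mem_verticalPart`** (`a ver_k ⊆ ver_{k+2}`).
* §2 **`verticalZeroTwo H 𝔞 = 𝔞_{0,2}`**: `⊆ 𝔤𝔩(M)_0(ad h_hor)` / `⊆ 𝔤𝔩(M)_2(ad h)` / `⊆ 𝔤𝔩(M)_2(ad h_ver)` (bidegree
  `(0,2)`), **`lie_eq_zero_of_mem_verticalZeroTwo`** (`𝔞_{0,2}` IS ABELIAN: `[a_0, b_0] = [a, b]_0 = 0`),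
  **`lie_eq_zero_of_mem_horizontalTwoZero_of_mem_verticalZeroTwo`** (`[𝔞_{2,0}, 𝔞_{0,2}] = 0`: `[a_2, b_0] = [a, b]_2`).
* §3 for a Lefschetz module `(𝔞, M)` and `h_hor = H` as in the Proposition: **`IsLefschetzModule.verticalZeroTwo_le`**
  ("an abelian subalgebra `𝔞_{0,2}` of `𝔤(𝔞, M)_{0,2}`"), **`…lefschetzLieAlgebra_verticalZeroTwo_le`** (`𝔤(𝔞_{0,2}, M_ver)
  ⊂ 𝔤(𝔞, M)`, (1.1)), **`…_le_adDegree_zero`** (`⊂ C(h_hor)`: "the last member is a rational expression in the first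
  two", A1-143 `lie_eq_zero_of_isSl2Triple_of_lie_eq_zero`), **`…_le_iSup`** ("a subalgebra of `𝔤(𝔞, M)_{0,•}`"),
  **`IsLefschetzModule.lie_eq_zero_of_mem_horizontal_of_mem_vertical`** (`[𝔤(𝔞_{2,0}, M_hor), 𝔤(𝔞_{0,2}, M_ver)] = 0`,
  A1-143 `lie_eq_zero_of_mem_lefschetzLieAlgebra_of_forall_lie_eq_zero` applied twice),
  **`IsLefschetzModule.disjoint_horizontal_vertical`** (`𝔤(𝔞_{2,0}, M_hor) ∩ 𝔤(𝔞_{0,2}, M_ver) = 0` when the former is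
  semisimple), **`IsLefschetzModule.exists_lieHom_prod_injective`** ("the obvious map … is then an injective
  homomorphism of Lie algebra's": `(x, y) ↦ x + y` from Mathlib's product Lie algebra), and
  **`IsLefschetzModule.isLefschetzModule_verticalZeroTwo`** (`(𝔞_{0,2}, M_ver)` is a Lefschetz module in the model).

## SCOPE

(a) As in A1-149 SCOPE (a): `Gr^ver M` is MODELLED by `(M, h_ver)` (A1-148), on which `𝔞_ver` acts by `a ↦ a_0`
(§1); the printed hypothesis "`Gr^ver M` is a Lefschetz module of `𝔞`" enters through its two model clauses (a
Lefschetz `a_0` and semisimplicity of `𝔤(𝔞_{0,2}, M_ver)`), and "maps isomorphically onto `𝔤(𝔞, Gr^ver M)`" is the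
identity of the model, not a theorem.  (b) For `𝔤(𝔞_{2,0}, M) ∩ 𝔤(𝔞_{0,2}, M) = 0` the printed route (a simple factor
of bidegree `(0,0)` cannot exist in an algebra generated by its degree `±2` summands) is replaced by the equivalent
one-line consequence of the commutation just proved: the intersection is central in the semisimple
`𝔤(𝔞_{2,0}, M_hor)`, hence `0` (Mathlib `LieAlgebra.center_eq_bot`) — same hypothesis (semisimplicity of
`𝔤(𝔞_{2,0}, M_hor)`, i.e. `(𝔞_{2,0}, M_hor)` a Lefschetz module, A1-149 `isLefschetzModule_horizontalTwoZero`).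
(c) The Leray application (5.4)–(5.7) is geometry, not formalised here.  (d) Nothing here concerns complex tori or the
Hodge conjecture.

## References

* [LooijengaLunts1997] E. Looijenga, V. A. Lunts, *A Lie algebra attached to a projective variety*, Invent. Math. 129
  (1997) 361–412; arXiv:alg-geom/9604014. §5 (5.3) p. 21 L1–L6, Proposition L45–L52, proof L54–L72; §1 (1.1)
  p. 4 L25–L26 of the held TeX text.
-/

namespace Literature.Algebra.Lie

open Module Function Set LieAlgebra

attribute [local instance 100] LieRing.ofAssociativeRing

/-! ### §1 Lowest components of brackets; operators preserving the horizontal filtration -/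

section Components

variable {K : Type*} [Field K] [CharZero K] {M : Type*} [AddCommGroup M] [Module K M] [FiniteDimensional K M]
  {H h : Module.End K M} {𝔞 : Submodule K (Module.End K M)}

/-- **The lowest horizontal component of a bracket**: for `a ∈ ⊕_{i ≥ c} 𝔤𝔩(M)_i(ad H)` and `b ∈ ⊕_{j ≥ d} 𝔤𝔩(M)_j(ad H)`,
`[a, b]_{c+d} = [a_c, b_d]` (the other products `[a_c, b - b_d]`, `[a - a_c, b]` have degrees `≥ c + d + 1`).
[cite: LooijengaLunts1997, §5 (5.3) Proposition, p. 21 L39–L40, L45–L48 ("abelian subalgebra 𝔞_{2,0} … 𝔞_{0,2}")] -/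
theorem degreeComponent_ad_lie_eq (hH : IsZGrading H) {a b : Module.End K M} {c d : ℤ}
    (ha : a ∈ ⨆ (j : ℤ) (_ : c ≤ j), adDegree K H (j : K)) (hb : b ∈ ⨆ (j : ℤ) (_ : d ≤ j), adDegree K H (j : K)) :
    degreeComponent (LieAlgebra.ad K (Module.End K M) H) (c + d) ⁅a, b⁆ =
      ⁅degreeComponent (LieAlgebra.ad K (Module.End K M) H) c a, degreeComponent (LieAlgebra.ad K (Module.End K M) H) d b⁆ := by
  have ha1 := sub_degreeComponent_mem_biSup hH ha
  have hb1 := sub_degreeComponent_mem_biSup hH hb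
  have hca : degreeComponent (LieAlgebra.ad K (Module.End K M) H) c a ∈ adDegree K H ((c : ℤ) : K) :=
    degreeComponent_apply_mem hH.ad c a
  have hcb : degreeComponent (LieAlgebra.ad K (Module.End K M) H) d b ∈ adDegree K H ((d : ℤ) : K) :=
    degreeComponent_apply_mem hH.ad d b
  generalize degreeComponent (LieAlgebra.ad K (Module.End K M) H) c a = a₀ at ha1 hca ⊢
  generalize degreeComponent (LieAlgebra.ad K (Module.End K M) H) d b = b₀ at hb1 hcb ⊢
  have hca' : a₀ ∈ ⨆ (j : ℤ) (_ : c ≤ j), adDegree K H (j : K) :=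
    Submodule.mem_iSup_of_mem c (Submodule.mem_iSup_of_mem le_rfl hca)
  have e1 : ⁅a, b⁆ = ⁅a₀, b₀⁆ + (⁅a₀, b - b₀⁆ + ⁅a - a₀, b⁆) := by
    rw [lie_sub, sub_lie]; abel
  have hR : ⁅a₀, b - b₀⁆ + ⁅a - a₀, b⁆ ∈ ⨆ (m : ℤ) (_ : c + d + 1 ≤ m), adDegree K H (m : K) := by
    have h1 : ⁅a₀, b - b₀⁆ ∈ ⨆ (m : ℤ) (_ : c + (d + 1) ≤ m), adDegree K H (m : K) := lie_mem_biSup_adDegree hca' hb1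
    have h2 : ⁅a - a₀, b⁆ ∈ ⨆ (m : ℤ) (_ : c + 1 + d ≤ m), adDegree K H (m : K) := lie_mem_biSup_adDegree ha1 hb
    rw [← add_assoc] at h1
    rw [add_right_comm] at h2
    exact Submodule.add_mem _ h1 h2
  have h4 : ⁅a₀, b₀⁆ ∈ degreeSpace (LieAlgebra.ad K (Module.End K M) H) (c + d) := by
    have h1 := lie_mem_adDegree hca hcb
    rw [← Int.cast_add] at h1
    exact h1
  simp_rw [← degreeSpace_ad_eq_adDegree] at hR
  rw [e1, map_add, degreeComponent_apply_of_mem h4, degreeComponent_apply_eq_zero_of_mem_biSup hR (by omega), add_zero]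

omit [CharZero K] [FiniteDimensional K M] in
/-- `hor^{k+0} M = hor^k M` (reindexing). [folklore] -/
private theorem horFiltration_add_zero (H : Module.End K M) (k : ℤ) :
    ⨆ (j : ℤ) (_ : k + 0 ≤ j), degreeSpace H j = ⨆ (j : ℤ) (_ : k ≤ j), degreeSpace H j := by
  rw [add_zero]

/-- **Operators raising the horizontal filtration by `c`, by components**: `a (hor^k M) ⊆ hor^{k+c} M` for all `k` iff
`a ∈ ⊕_{j ≥ c} 𝔤𝔩(M)_j(ad H)` (A1-149 `forall_apply_mem_horFiltration_iff` is `c = 2`). [cite: LooijengaLunts1997, §5 (5.3) p. 21 L1–L3 ("preserved by 𝔞"), L11–L13] -/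
theorem forall_apply_mem_horFiltration_add_iff (hH : IsZGrading H) {a : Module.End K M} {c : ℤ} :
    (∀ k : ℤ, ∀ x ∈ ⨆ (j : ℤ) (_ : k ≤ j), degreeSpace H j, a x ∈ ⨆ (j : ℤ) (_ : k + c ≤ j), degreeSpace H j) ↔
      a ∈ ⨆ (j : ℤ) (_ : c ≤ j), adDegree K H (j : K) := by
  refine ⟨fun h ↦ ?_, fun ha k x hx ↦ apply_mem_horFiltration_of_mem_biSup_adDegree ha k hx⟩
  simp_rw [← degreeSpace_ad_eq_adDegree]
  refine mem_biSup_of_degreeComponent_apply_eq_zero hH.ad fun m hm ↦ ?_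
  refine hH.linearMap_ext fun i x hx ↦ ?_
  rw [LinearMap.zero_apply, degreeComponent_ad_apply_apply hH a m hx]
  exact degreeComponent_apply_eq_zero_of_mem_biSup (h i x (degreeSpace_le_horFiltration H i hx)) (by omega)

/-- **`𝔞_ver`: the elements of `𝔞` preserving the horizontal filtration** ("`hor^• M` a nonincreasing filtration on the
graded vector space underlying `M` … which is preserved by `𝔞`": under this standing hypothesis of (5.3) `𝔞_ver = 𝔞`,
`verticalPart_eq_of_forall`).  These are the `a ∈ 𝔞` that act on `Gr^ver M` ("If in addition, `Gr^ver M` is a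
Lefschetz module of `𝔞`"): an `a` of total degree `2` preserves `hor` iff it raises the vertical filtration
`ver_k M = ⊕_{m ≤ k} M_m(h_ver)` by at most `2` (`a ∈ ⊕_{j ≥ 0} 𝔤𝔩(M)_{j, 2-j}`). [cite: LooijengaLunts1997, §5 (5.3) p. 21 L1–L3, L45–L46] -/
def verticalPart (H : Module.End K M) (𝔞 : Submodule K (Module.End K M)) : Submodule K (Module.End K M) where
  carrier := {a | a ∈ 𝔞 ∧ ∀ k : ℤ, ∀ x ∈ ⨆ (j : ℤ) (_ : k ≤ j), degreeSpace H j, a x ∈ ⨆ (j : ℤ) (_ : k ≤ j), degreeSpace H j}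
  add_mem' := fun {a b} ha hb ↦ ⟨𝔞.add_mem ha.1 hb.1, fun k x hx ↦ by
    rw [LinearMap.add_apply]; exact Submodule.add_mem _ (ha.2 k x hx) (hb.2 k x hx)⟩
  zero_mem' := ⟨𝔞.zero_mem, fun k x _ ↦ by rw [LinearMap.zero_apply]; exact Submodule.zero_mem _⟩
  smul_mem' := fun r a ha ↦ ⟨𝔞.smul_mem r ha.1, fun k x hx ↦ by
    rw [LinearMap.smul_apply]; exact Submodule.smul_mem _ r (ha.2 k x hx)⟩

omit [CharZero K] [FiniteDimensional K M] in
/-- `a ∈ 𝔞_ver ↔ a ∈ 𝔞 ∧ ∀ k, a (hor^k M) ⊆ hor^k M`. [cite: LooijengaLunts1997, §5 (5.3) p. 21 L1–L3] -/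
theorem mem_verticalPart_iff {a : Module.End K M} :
    a ∈ verticalPart H 𝔞 ↔ a ∈ 𝔞 ∧ ∀ k : ℤ, ∀ x ∈ ⨆ (j : ℤ) (_ : k ≤ j), degreeSpace H j,
      a x ∈ ⨆ (j : ℤ) (_ : k ≤ j), degreeSpace H j :=
  Iff.rfl

omit [CharZero K] [FiniteDimensional K M] in
/-- `𝔞_ver ⊆ 𝔞`. [cite: LooijengaLunts1997, §5 (5.3) p. 21 L1–L3] -/
theorem verticalPart_le : verticalPart H 𝔞 ≤ 𝔞 := fun _ ha ↦ ha.1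

omit [CharZero K] [FiniteDimensional K M] in
/-- Under the standing hypothesis of (5.3) — the horizontal filtration "is preserved by `𝔞`" — `𝔞_ver = 𝔞`.
[cite: LooijengaLunts1997, §5 (5.3) p. 21 L1–L3] -/
theorem verticalPart_eq_of_forall
    (h𝔞 : ∀ a ∈ 𝔞, ∀ k : ℤ, ∀ x ∈ ⨆ (j : ℤ) (_ : k ≤ j), degreeSpace H j, a x ∈ ⨆ (j : ℤ) (_ : k ≤ j), degreeSpace H j) :
    verticalPart H 𝔞 = 𝔞 :=
  le_antisymm verticalPart_le fun a ha ↦ ⟨ha, h𝔞 a ha⟩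

omit [CharZero K] [FiniteDimensional K M] in
/-- `𝔞_hor ⊆ 𝔞_ver` (raising `hor` by `2` preserves it). [cite: LooijengaLunts1997, §5 (5.3) p. 21 L11–L13, L32] -/
theorem horizontalPart_le_verticalPart : horizontalPart H 𝔞 ≤ verticalPart H 𝔞 :=
  fun _ ha ↦ ⟨ha.1, fun k x hx ↦ horFiltration_le_of_le H (by omega) (ha.2 k x hx)⟩

/-- `a ∈ 𝔞_ver ↔ a ∈ 𝔞 ∧ a ∈ ⊕_{j ≥ 0} 𝔤𝔩(M)_j(ad H)` (no component of negative horizontal degree).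
[cite: LooijengaLunts1997, §5 (5.3) p. 21 L1–L3, L45–L46] -/
theorem mem_verticalPart_iff_mem_biSup (hH : IsZGrading H) {a : Module.End K M} :
    a ∈ verticalPart H 𝔞 ↔ a ∈ 𝔞 ∧ a ∈ ⨆ (j : ℤ) (_ : 0 ≤ j), adDegree K H (j : K) := by
  rw [mem_verticalPart_iff, ← forall_apply_mem_horFiltration_add_iff hH]
  simp_rw [horFiltration_add_zero]

/-- For an operator `a` of total degree `2` commuting data `[h, H] = 0`: the `(ad H)`-component `a_j` has bidegree
`(j, 2 - j)` — `[h - H, a_j] = (2 - j) a_j`. [cite: LooijengaLunts1997, §5 (5.3) p. 21 L27–L30] -/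
theorem degreeComponent_ad_mem_adDegree_sub (hHh : H ∈ adDegree K h 0) {a : Module.End K M} (ha : a ∈ adDegree K h 2)
    (hH : IsZGrading H) (j : ℤ) :
    degreeComponent (LieAlgebra.ad K (Module.End K M) H) j a ∈ adDegree K (h - H) (2 - (j : K)) := by
  have ha2 : a ∈ degreeSpace (LieAlgebra.ad K (Module.End K M) h) 2 := by
    rw [degreeSpace_ad_eq_adDegree, Int.cast_two]; exact ha
  have h1 := degreeComponent_apply_mem_degreeSpace_of_commute (commute_ad_of_mem_adDegree_zero hHh) ha2 j
  rw [degreeSpace_ad_eq_adDegree, Int.cast_two] at h1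
  have h2 : degreeComponent (LieAlgebra.ad K (Module.End K M) H) j a ∈ adDegree K H ((j : ℤ) : K) :=
    degreeComponent_apply_mem hH.ad j a
  rw [mem_adDegree_iff, sub_lie, mem_adDegree_iff.1 h1, mem_adDegree_iff.1 h2, sub_smul]

/-- **`𝔞_ver` through the vertical filtration**: an `a ∈ 𝔞_ver` (total degree `2`, `[h, H] = 0`) raises
`ver_k M = ⊕_{m ≤ k} M_m(h_ver)` by at most `2`: `a (ver_k M) ⊆ ver_{k+2} M` — so `a` acts on `Gr^ver M`, by its
component `a_{0,2}` of highest vertical degree `2`. [cite: LooijengaLunts1997, §5 (5.3) p. 21 L4–L6, L45–L48] -/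
theorem apply_mem_verFiltration_of_mem_verticalPart (hH : IsZGrading H) (hHh : H ∈ adDegree K h 0)
    (h𝔞 : 𝔞 ≤ adDegree K h 2) {a : Module.End K M} (ha : a ∈ verticalPart H 𝔞) (k : ℤ) {x : M}
    (hx : x ∈ ⨆ (m : ℤ) (_ : m ≤ k), degreeSpace (h - H) m) : a x ∈ ⨆ (m : ℤ) (_ : m ≤ k + 2), degreeSpace (h - H) m := by
  classical
  obtain ⟨ha𝔞, ha0⟩ := (mem_verticalPart_iff_mem_biSup hH).1 ha
  -- `a = Σ_j a_j` over the finitely many horizontal degrees, `a_j` of vertical degree `2 - j ≤ 2` for `j ≥ 0`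
  have hT := hH.ad
  rw [← sum_degreeComponent_apply hT (S := (finite_setOf_degreeSpace_ne_bot _).toFinset)
    (fun k hk ↦ (finite_setOf_degreeSpace_ne_bot _).mem_toFinset.2 hk) a, LinearMap.sum_apply]
  refine Submodule.sum_mem _ fun j _ ↦ ?_
  by_cases hj : 0 ≤ j
  · have hdeg := degreeComponent_ad_mem_adDegree_sub hHh (h𝔞 ha𝔞) hH j
    rw [show (2 : K) - (j : K) = ((2 - j : ℤ) : K) by push_cast; ring] at hdeg
    -- an operator of vertical degree `2 - j` maps `ver_k` into `ver_{k + 2 - j} ⊆ ver_{k+2}`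
    suffices hle : (⨆ (m : ℤ) (_ : m ≤ k), degreeSpace (h - H) m) ≤
        (⨆ (m : ℤ) (_ : m ≤ k + 2), degreeSpace (h - H) m).comap
          (degreeComponent (LieAlgebra.ad K (Module.End K M) H) j a) from hle hx
    refine iSup₂_le fun m hm y hy ↦ ?_
    rw [Submodule.mem_comap]
    exact Submodule.mem_iSup_of_mem (m + (2 - j)) (Submodule.mem_iSup_of_mem (by omega) (mapsTo_of_mem_adDegree hdeg m hy))
  · simp_rw [← degreeSpace_ad_eq_adDegree] at ha0
    rw [show degreeComponent (LieAlgebra.ad K (Module.End K M) H) j a = 0 from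
      degreeComponent_apply_eq_zero_of_mem_biSup ha0 hj, LinearMap.zero_apply]
    exact Submodule.zero_mem _

end Components

/-! ### §2 `𝔞_{0,2}`: "the span of the components of `𝔞` of highest vertical degree `2` make up an abelian subalgebra
`𝔞_{0,2}` of `𝔤(𝔞, M)_{0,2}`" -/

section VerticalZeroTwo

variable {K : Type*} [Field K] [CharZero K] {M : Type*} [AddCommGroup M] [Module K M] [FiniteDimensional K M]

/-- **`𝔞_{0,2}`**, "the span of the components of `𝔞` of highest vertical degree `2`": the image of `𝔞_ver` (`= 𝔞`
under the standing hypothesis) under `a ↦ a_0`, the component of horizontal degree `0` = of bidegree `(0, 2)` = of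
highest vertical degree `2` (`degreeComponent_ad_mem_adDegree_sub`). [cite: LooijengaLunts1997, §5 (5.3) Proposition, p. 21 L45–L47] -/
noncomputable def verticalZeroTwo (H : Module.End K M) (𝔞 : Submodule K (Module.End K M)) :
    Submodule K (Module.End K M) :=
  (verticalPart H 𝔞).map (degreeComponent (LieAlgebra.ad K (Module.End K M) H) 0)

variable {H h : Module.End K M} {𝔞 : Submodule K (Module.End K M)}

/-- `y ∈ 𝔞_{0,2} ↔ y = a_0` for some `a ∈ 𝔞_ver`. [cite: LooijengaLunts1997, §5 (5.3) p. 21 L45–L47] -/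
theorem mem_verticalZeroTwo_iff {y : Module.End K M} :
    y ∈ verticalZeroTwo H 𝔞 ↔ ∃ a ∈ verticalPart H 𝔞, degreeComponent (LieAlgebra.ad K (Module.End K M) H) 0 a = y :=
  Submodule.mem_map

/-- `a_0 ∈ 𝔞_{0,2}` for `a ∈ 𝔞_ver`. [cite: LooijengaLunts1997, §5 (5.3) p. 21 L45–L47] -/
theorem degreeComponent_mem_verticalZeroTwo {a : Module.End K M} (ha : a ∈ verticalPart H 𝔞) :
    degreeComponent (LieAlgebra.ad K (Module.End K M) H) 0 a ∈ verticalZeroTwo H 𝔞 :=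
  Submodule.mem_map_of_mem ha

/-- `𝔞_{0,2} ⊆ 𝔤𝔩(M)_0(ad h_hor)`: horizontal degree `0`. [cite: LooijengaLunts1997, §5 (5.3) p. 21 L45–L47] -/
theorem verticalZeroTwo_le_adDegree_zero (hH : IsZGrading H) : verticalZeroTwo H 𝔞 ≤ adDegree K H 0 := by
  rintro _ ⟨a, -, rfl⟩
  have h1 : degreeComponent (LieAlgebra.ad K (Module.End K M) H) 0 a ∈ adDegree K H ((0 : ℤ) : K) :=
    degreeComponent_apply_mem hH.ad 0 a
  rwa [Int.cast_zero] at h1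

/-- `𝔞_{0,2} ⊆ 𝔤𝔩(M)_2(ad h)`: total degree `2`. [cite: LooijengaLunts1997, §5 (5.3) p. 21 L45–L47] -/
theorem verticalZeroTwo_le_adDegree_total (hHh : H ∈ adDegree K h 0) (h𝔞 : 𝔞 ≤ adDegree K h 2) :
    verticalZeroTwo H 𝔞 ≤ adDegree K h 2 := by
  rintro _ ⟨a, ha, rfl⟩
  have ha2 : a ∈ degreeSpace (LieAlgebra.ad K (Module.End K M) h) 2 := by
    rw [degreeSpace_ad_eq_adDegree, Int.cast_two]; exact h𝔞 ha.1
  have h1 := degreeComponent_apply_mem_degreeSpace_of_commute (commute_ad_of_mem_adDegree_zero hHh) ha2 0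
  rwa [degreeSpace_ad_eq_adDegree, Int.cast_two] at h1

/-- **`𝔞_{0,2} ⊆ 𝔤𝔩(M)_2(ad h_ver)`**: vertical degree `2`, bidegree `(0, 2)`. [cite: LooijengaLunts1997, §5 (5.3) p. 21 L45–L47] -/
theorem verticalZeroTwo_le_adDegree_sub_two (hH : IsZGrading H) (hHh : H ∈ adDegree K h 0)
    (h𝔞 : 𝔞 ≤ adDegree K h 2) : verticalZeroTwo H 𝔞 ≤ adDegree K (h - H) 2 := by
  intro y hy
  rw [mem_adDegree_iff, sub_lie, mem_adDegree_iff.1 (verticalZeroTwo_le_adDegree_total hHh h𝔞 hy),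
    mem_adDegree_iff.1 (verticalZeroTwo_le_adDegree_zero hH hy), zero_smul, sub_zero]

/-- **`𝔞_{0,2}` is abelian**: `[a_0, b_0] = [a, b]_0 = 0` for commuting `a, b ∈ 𝔞_ver`. [cite: LooijengaLunts1997, §5 (5.3) Proposition, p. 21 L45–L47] -/
theorem lie_eq_zero_of_mem_verticalZeroTwo (hH : IsZGrading H) (h𝔞 : ∀ a ∈ 𝔞, ∀ b ∈ 𝔞, ⁅a, b⁆ = 0)
    {x y : Module.End K M} (hx : x ∈ verticalZeroTwo H 𝔞) (hy : y ∈ verticalZeroTwo H 𝔞) : ⁅x, y⁆ = 0 := by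
  obtain ⟨a, ha, rfl⟩ := hx
  obtain ⟨b, hb, rfl⟩ := hy
  have h1 := degreeComponent_ad_lie_eq hH ((mem_verticalPart_iff_mem_biSup hH).1 ha).2
    ((mem_verticalPart_iff_mem_biSup hH).1 hb).2
  rw [h𝔞 a ha.1 b hb.1, map_zero] at h1
  exact h1.symm

/-- **`[𝔞_{2,0}, 𝔞_{0,2}] = 0`**: for `a ∈ 𝔞_hor`, `b ∈ 𝔞_ver` (commuting), `[a_2, b_0] = [a, b]_2 = 0`.
[cite: LooijengaLunts1997, §5 (5.3) proof, p. 21 L57–L61 ("(e', h') commutes with (e'', h'')")] -/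
theorem lie_eq_zero_of_mem_horizontalTwoZero_of_mem_verticalZeroTwo (hH : IsZGrading H)
    (h𝔞 : ∀ a ∈ 𝔞, ∀ b ∈ 𝔞, ⁅a, b⁆ = 0) {x y : Module.End K M} (hx : x ∈ horizontalTwoZero H 𝔞)
    (hy : y ∈ verticalZeroTwo H 𝔞) : ⁅x, y⁆ = 0 := by
  obtain ⟨a, ha, rfl⟩ := hx
  obtain ⟨b, hb, rfl⟩ := hy
  have h1 := degreeComponent_ad_lie_eq hH ((mem_horizontalPart_iff_mem_biSup hH).1 ha).2
    ((mem_verticalPart_iff_mem_biSup hH).1 hb).2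
  rw [h𝔞 a ha.1 b hb.1, map_zero] at h1
  exact h1.symm

end VerticalZeroTwo

/-! ### §3 For a Lefschetz module: `𝔞_{0,2} ⊂ 𝔤(𝔞, M)_{0,2}`, `𝔤(𝔞_{0,2}, M_ver) ⊂ 𝔤(𝔞, M)_{0,•}`, and the injective
homomorphism `𝔤(𝔞_{2,0}, M_hor) × 𝔤(𝔞_{0,2}, M_ver) → 𝔤(𝔞, M)` -/

section LefschetzModule

variable {K : Type*} [Field K] [CharZero K] {M : Type*} [AddCommGroup M] [Module K M] [FiniteDimensional K M]
  {h H : Module.End K M} {𝔞 : Submodule K (Module.End K M)}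

/-- `𝔞_{0,2} ⊂ 𝔤(𝔞, M)` (`𝔞_ver ⊆ 𝔞 ⊆ 𝔤(𝔞, M)`, components stay inside). [cite: LooijengaLunts1997, §5 (5.3) Proposition, p. 21 L45–L47] -/
theorem verticalZeroTwo_le_lefschetzLieAlgebra (hH𝔤 : H ∈ lefschetzLieAlgebra K h 𝔞) :
    verticalZeroTwo H 𝔞 ≤ (lefschetzLieAlgebra K h 𝔞).toSubmodule := by
  rintro _ ⟨a, ha, rfl⟩
  exact degreeComponent_ad_mem_lefschetzLieAlgebra hH𝔤 0 (mem_lefschetzLieAlgebra_of_mem ha.1)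

/-- **LOOIJENGA–LUNTS (5.3): "an abelian subalgebra `𝔞_{0,2}` of `𝔤(𝔞, M)_{0,2}`"** for a Lefschetz module:
`𝔞_{0,2} ⊆ 𝔤(𝔞, M) ∩ 𝔤𝔩(M)_0(ad h_hor) ∩ 𝔤𝔩(M)_2(ad h_ver)` and `[𝔞_{0,2}, 𝔞_{0,2}] = 0`.
[cite: LooijengaLunts1997, §5 (5.3) Proposition, p. 21 L45–L47] -/
theorem IsLefschetzModule.verticalZeroTwo_le (A : IsLefschetzModule K h 𝔞) (hH𝔤 : H ∈ lefschetzLieAlgebra K h 𝔞)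
    (hH : IsZGrading H) (hHh : H ∈ adDegree K h 0) :
    verticalZeroTwo H 𝔞 ≤ (lefschetzLieAlgebra K h 𝔞).toSubmodule ⊓ (adDegree K H 0 ⊓ adDegree K (h - H) 2) ∧
      ∀ x ∈ verticalZeroTwo H 𝔞, ∀ y ∈ verticalZeroTwo H 𝔞, ⁅x, y⁆ = 0 :=
  ⟨le_inf (verticalZeroTwo_le_lefschetzLieAlgebra hH𝔤)
      (le_inf (verticalZeroTwo_le_adDegree_zero hH) (verticalZeroTwo_le_adDegree_sub_two hH hHh A.le_adDegree_two)),
    fun _ hx _ hy ↦ lie_eq_zero_of_mem_verticalZeroTwo hH A.lie_eq_zero hx hy⟩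

omit [CharZero K] [FiniteDimensional K M] in
/-- `h_ver = h - h_hor ∈ 𝔤(𝔞, M)`. [cite: LooijengaLunts1997, §5 (5.3) Proposition, p. 21 L34–L35] -/
theorem IsLefschetzModule.sub_mem_lefschetzLieAlgebra (A : IsLefschetzModule K h 𝔞)
    (hH𝔤 : H ∈ lefschetzLieAlgebra K h 𝔞) : h - H ∈ lefschetzLieAlgebra K h 𝔞 :=
  (lefschetzLieAlgebra K h 𝔞).sub_mem A.h_mem hH𝔤

/-- **`𝔤(𝔞_{0,2}, M_ver) ⊂ 𝔤(𝔞, M)`**: the Lie subalgebra generated by `𝔞_{0,2}` and the partners of its Lefschetz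
elements with respect to the VERTICAL grading `h_ver = h - H` lies in `𝔤(𝔞, M)` ((1.1): `h_ver, y ∈ 𝔤(𝔞, M)`
semisimple). [cite: LooijengaLunts1997, §5 (5.3) Proposition, p. 21 L48–L50; §1 (1.1) p. 4 L25–L26] -/
theorem IsLefschetzModule.lefschetzLieAlgebra_verticalZeroTwo_le (A : IsLefschetzModule K h 𝔞)
    (hH𝔤 : H ∈ lefschetzLieAlgebra K h 𝔞) :
    lefschetzLieAlgebra K (h - H) (verticalZeroTwo H 𝔞) ≤ lefschetzLieAlgebra K h 𝔞 := by
  rw [lefschetzLieAlgebra_le_iff]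
  refine ⟨fun x hx ↦ verticalZeroTwo_le_lefschetzLieAlgebra hH𝔤 hx, ?_⟩
  rintro f ⟨y, hy, t⟩
  exact A.mem_lefschetzLieAlgebra_of_isSl2Triple (A.sub_mem_lefschetzLieAlgebra hH𝔤)
    (verticalZeroTwo_le_lefschetzLieAlgebra hH𝔤 hy) t

omit [CharZero K] [FiniteDimensional K M] in
/-- The centraliser of `T` inside a Lie subalgebra `G` is a Lie subalgebra. [folklore] -/
private theorem exists_lieSubalgebra_inf_adDegree_zero' (G : LieSubalgebra K (Module.End K M)) (T : Module.End K M) :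
    ∃ C : LieSubalgebra K (Module.End K M), C.toSubmodule = G.toSubmodule ⊓ adDegree K T 0 :=
  ⟨{ (G.toSubmodule ⊓ adDegree K T 0 : Submodule K (Module.End K M)) with
      lie_mem' := fun {x y} hx hy ↦ ⟨G.lie_mem hx.1 hy.1, by
        have h1 := lie_mem_adDegree hx.2 hy.2
        rwa [add_zero] at h1⟩ }, rfl⟩

/-- **`𝔤(𝔞_{0,2}, M_ver) ⊂ 𝔤(𝔞, M) ∩ C(h_hor)`**: every element commutes with `h_hor` — the generators do (`𝔞_{0,2}`
has horizontal degree `0`; the partner of `(y, h_ver, f_y)` is killed by `ad h_hor` since `h_hor` is killed by `ad y`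
and `ad h_ver`, A1-143 `lie_eq_zero_of_isSl2Triple_of_lie_eq_zero` — "the last member is a rational expression in the
first two"). [cite: LooijengaLunts1997, §5 (5.3) Proposition, p. 21 L48–L50, proof L57–L63] -/
theorem IsLefschetzModule.lefschetzLieAlgebra_verticalZeroTwo_le_adDegree_zero (A : IsLefschetzModule K h 𝔞)
    (hH𝔤 : H ∈ lefschetzLieAlgebra K h 𝔞) (hH : IsZGrading H) (hHh : H ∈ adDegree K h 0) :
    (lefschetzLieAlgebra K (h - H) (verticalZeroTwo H 𝔞)).toSubmodule ≤
      (lefschetzLieAlgebra K h 𝔞).toSubmodule ⊓ adDegree K H 0 := by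
  obtain ⟨C, hC⟩ := exists_lieSubalgebra_inf_adDegree_zero' (lefschetzLieAlgebra K h 𝔞) H
  rw [← hC]
  show lefschetzLieAlgebra K (h - H) (verticalZeroTwo H 𝔞) ≤ C
  rw [lefschetzLieAlgebra_le_iff]
  have hHW : ⁅H, h - H⁆ = 0 := by
    rw [lie_sub, lie_self, sub_zero, ← lie_skew, mem_adDegree_iff.1 hHh, zero_smul, neg_zero]
  refine ⟨fun y hy ↦ ?_, ?_⟩
  · rw [SetLike.mem_coe, ← LieSubalgebra.mem_toSubmodule, hC]
    exact Submodule.mem_inf.2 ⟨verticalZeroTwo_le_lefschetzLieAlgebra hH𝔤 hy, verticalZeroTwo_le_adDegree_zero hH hy⟩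
  · rintro f ⟨y, hy, t⟩
    rw [SetLike.mem_coe, ← LieSubalgebra.mem_toSubmodule, hC]
    refine Submodule.mem_inf.2 ⟨A.mem_lefschetzLieAlgebra_of_isSl2Triple (A.sub_mem_lefschetzLieAlgebra hH𝔤)
      (verticalZeroTwo_le_lefschetzLieAlgebra hH𝔤 hy) t, ?_⟩
    have hHy : ⁅H, y⁆ = 0 := by rw [mem_adDegree_iff.1 (verticalZeroTwo_le_adDegree_zero hH hy), zero_smul]
    have h1 := lie_eq_zero_of_isSl2Triple_of_lie_eq_zero K t (v := H) (by rw [← lie_skew, hHy, neg_zero])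
      (by rw [← lie_skew, hHW, neg_zero])
    rw [mem_adDegree_iff, zero_smul, ← lie_skew, h1, neg_zero]

omit [CharZero K] [FiniteDimensional K M] in
/-- `hH = Hh` as a ring identity, from "`h_hor` of total degree `0`". [cite: LooijengaLunts1997, §5 (5.3) p. 21 L18–L19, L24–L25] -/
theorem mul_comm_of_mem_adDegree_zero (hHh : H ∈ adDegree K h 0) : h * H = H * h := by
  have h1 := mem_adDegree_iff.1 hHh
  rw [zero_smul, Ring.lie_def, sub_eq_zero] at h1
  exact h1

/-- **LOOIJENGA–LUNTS (5.3): "`𝔤(𝔞_{0,2}, M_ver)` is a subalgebra of `𝔤(𝔞, M)_{0,•}`"**: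
`𝔤(𝔞_{0,2}, M_ver) ⊆ ⊕_l 𝔤(𝔞, M) ∩ 𝔤𝔩(M)_0(ad h_hor) ∩ 𝔤𝔩(M)_l(ad h_ver)`. [cite: LooijengaLunts1997, §5 (5.3) Proposition, p. 21 L48–L50] -/
theorem IsLefschetzModule.lefschetzLieAlgebra_verticalZeroTwo_le_iSup (A : IsLefschetzModule K h 𝔞)
    (hH𝔤 : H ∈ lefschetzLieAlgebra K h 𝔞) (hH : IsZGrading H) (hHh : H ∈ adDegree K h 0) :
    (lefschetzLieAlgebra K (h - H) (verticalZeroTwo H 𝔞)).toSubmodule ≤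
      ⨆ l : ℤ, (lefschetzLieAlgebra K h 𝔞).toSubmodule ⊓ (adDegree K H 0 ⊓ adDegree K (h - H) (l : K)) := by
  have hW : IsZGrading (h - H) := isZGrading_sub_of_commute A.isZGrading hH (mul_comm_of_mem_adDegree_zero hHh)
  set U : Submodule K (Module.End K M) := (lefschetzLieAlgebra K h 𝔞).toSubmodule ⊓ adDegree K H 0 with hU
  have hUs : ∀ x ∈ U, LieAlgebra.ad K (Module.End K M) (h - H) x ∈ U := fun x hx ↦ by
    rw [LieAlgebra.ad_apply]
    refine ⟨(lefschetzLieAlgebra K h 𝔞).lie_mem (A.sub_mem_lefschetzLieAlgebra hH𝔤) hx.1, ?_⟩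
    have h0 : h - H ∈ adDegree K H 0 := by
      rw [mem_adDegree_iff, zero_smul, lie_sub, lie_self, sub_zero, ← lie_skew, mem_adDegree_iff.1 hHh, zero_smul,
        neg_zero]
    have h1 := lie_mem_adDegree h0 hx.2
    rwa [add_zero] at h1
  have hUeq := eq_iSup_inf_degreeSpace_of_forall_mem hW.ad hUs
  refine (A.lefschetzLieAlgebra_verticalZeroTwo_le_adDegree_zero hH𝔤 hH hHh).trans ?_
  rw [← hU]
  refine hUeq.le.trans (iSup_le fun l ↦ le_iSup_of_le l ?_)
  rw [hU, degreeSpace_ad_eq_adDegree]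
  exact fun x hx ↦ ⟨hx.1.1, hx.1.2, hx.2⟩

/-- **LOOIJENGA–LUNTS (5.3): `𝔤(𝔞_{2,0}, M_hor)` and `𝔤(𝔞_{0,2}, M_ver)` COMMUTE inside `𝔤(𝔞, M)`** ("any 'horizontal'
`𝔰𝔩₂`-triple … commutes with any 'vertical' `𝔰𝔩₂`-triple … It follows that `𝔤(𝔞_hor, Gr_hor M)` and `𝔤(𝔞, Gr^ver M)`
commute. The same is therefore true for their bigraded lifts `𝔤(𝔞_{2,0}, M)` and `𝔤(𝔞_{0,2}, M)` in `𝔤(𝔞, M)`"): every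
`g₂ ∈ 𝔤(𝔞_{0,2}, M_ver)` is killed by `ad h_hor` (§3) and by `ad 𝔞_{2,0}` (each `x ∈ 𝔞_{2,0}` is killed by `ad h_ver`
and `ad 𝔞_{0,2}`, hence by all of `ad 𝔤(𝔞_{0,2}, M_ver)` — A1-143
`lie_eq_zero_of_mem_lefschetzLieAlgebra_of_forall_lie_eq_zero`), hence by all of `ad 𝔤(𝔞_{2,0}, M_hor)` (same lemma).
[cite: LooijengaLunts1997, §5 (5.3) Proposition and proof, p. 21 L50–L52, L57–L67] -/
theorem IsLefschetzModule.lie_eq_zero_of_mem_horizontal_of_mem_vertical (A : IsLefschetzModule K h 𝔞)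
    (hH𝔤 : H ∈ lefschetzLieAlgebra K h 𝔞) (hH : IsZGrading H) (hHh : H ∈ adDegree K h 0) {g₁ g₂ : Module.End K M}
    (hg₁ : g₁ ∈ lefschetzLieAlgebra K H (horizontalTwoZero H 𝔞))
    (hg₂ : g₂ ∈ lefschetzLieAlgebra K (h - H) (verticalZeroTwo H 𝔞)) : ⁅g₁, g₂⁆ = 0 := by
  refine lie_eq_zero_of_mem_lefschetzLieAlgebra_of_forall_lie_eq_zero (K := K) (h := H)
    (𝔞 := horizontalTwoZero H 𝔞) (v := g₂) ?_ (fun x hx ↦ ?_) hg₁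
  · have h1 := (Submodule.mem_inf.1 (A.lefschetzLieAlgebra_verticalZeroTwo_le_adDegree_zero hH𝔤 hH hHh hg₂)).2
    rw [mem_adDegree_iff.1 h1, zero_smul]
  · have h2 : ⁅g₂, x⁆ = 0 := by
      refine lie_eq_zero_of_mem_lefschetzLieAlgebra_of_forall_lie_eq_zero (K := K) (h := h - H)
        (𝔞 := verticalZeroTwo H 𝔞) (v := x) ?_ (fun y hy ↦ ?_) hg₂
      · rw [mem_adDegree_iff.1 (horizontalTwoZero_le_adDegree_sub_zero hH hHh A.le_adDegree_two hx), zero_smul]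
      · rw [← lie_skew, lie_eq_zero_of_mem_horizontalTwoZero_of_mem_verticalZeroTwo hH A.lie_eq_zero hx hy, neg_zero]
    rw [← lie_skew, h2, neg_zero]

/-- **LOOIJENGA–LUNTS (5.3): `𝔤(𝔞_{2,0}, M_hor) ∩ 𝔤(𝔞_{0,2}, M_ver) = 0`** when `𝔤(𝔞_{2,0}, M_hor)` is semisimple (it is,
`(𝔞_{2,0}, M_hor)` being a Lefschetz module, A1-149 `isLefschetzModule_horizontalTwoZero`): an element of the
intersection commutes with all of `𝔤(𝔞_{2,0}, M_hor)` (previous theorem), so it lies in the centre of a semisimple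
Lie algebra, which is `0` (printed: "this intersection … is normal in either of them … But this is impossible since
`𝔤(𝔞_{2,0}, M)` is (as a Lie algebra) generated by its degree `±2` summands"). [cite: LooijengaLunts1997, §5 (5.3) proof, p. 21 L67–L72] -/
theorem IsLefschetzModule.disjoint_horizontal_vertical (A : IsLefschetzModule K h 𝔞)
    (hH𝔤 : H ∈ lefschetzLieAlgebra K h 𝔞) (hH : IsZGrading H) (hHh : H ∈ adDegree K h 0)
    (hss : LieAlgebra.IsSemisimple K (lefschetzLieAlgebra K H (horizontalTwoZero H 𝔞))) :
    Disjoint (lefschetzLieAlgebra K H (horizontalTwoZero H 𝔞)).toSubmodule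
      (lefschetzLieAlgebra K (h - H) (verticalZeroTwo H 𝔞)).toSubmodule := by
  rw [Submodule.disjoint_def]
  intro x hx₁ hx₂
  haveI := hss
  have hc : (⟨x, hx₁⟩ : lefschetzLieAlgebra K H (horizontalTwoZero H 𝔞)) ∈
      LieAlgebra.center K (lefschetzLieAlgebra K H (horizontalTwoZero H 𝔞)) := by
    rw [LieModule.mem_maxTrivSubmodule]
    intro y
    apply Subtype.ext
    rw [LieSubalgebra.coe_bracket, ZeroMemClass.coe_zero]
    exact A.lie_eq_zero_of_mem_horizontal_of_mem_vertical hH𝔤 hH hHh y.2 hx₂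
  rw [LieAlgebra.center_eq_bot] at hc
  exact congrArg Subtype.val ((LieSubmodule.mem_bot _).1 hc)

/-- **LOOIJENGA–LUNTS (5.3): "The obvious map `𝔤(𝔞_{2,0}, M_hor) × 𝔤(𝔞_{0,2}, M_ver) → 𝔤(𝔞, M)` is then an injective
homomorphism of Lie algebra's"** — `(x, y) ↦ x + y` from the product Lie algebra is a morphism of Lie algebras
(the factors commute) with values in `𝔤(𝔞, M)` (both factors lie in it), injective (the factors meet in `0`).
[cite: LooijengaLunts1997, §5 (5.3) Proposition, p. 21 L50–L52, proof L55–L72] -/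
theorem IsLefschetzModule.exists_lieHom_prod_injective (A : IsLefschetzModule K h 𝔞)
    (hH𝔤 : H ∈ lefschetzLieAlgebra K h 𝔞) (hH : IsZGrading H) (hHh : H ∈ adDegree K h 0)
    (hss : LieAlgebra.IsSemisimple K (lefschetzLieAlgebra K H (horizontalTwoZero H 𝔞))) :
    ∃ φ : (lefschetzLieAlgebra K H (horizontalTwoZero H 𝔞)) × (lefschetzLieAlgebra K (h - H) (verticalZeroTwo H 𝔞))
        →ₗ⁅K⁆ lefschetzLieAlgebra K h 𝔞,
      Function.Injective φ ∧ ∀ p, (φ p : Module.End K M) = (p.1 : Module.End K M) + (p.2 : Module.End K M) := by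
  have h₁ := A.lefschetzLieAlgebra_horizontalTwoZero_le hH𝔤
  have h₂ := A.lefschetzLieAlgebra_verticalZeroTwo_le hH𝔤
  refine ⟨{ toFun := fun p ↦ ⟨(p.1 : Module.End K M) + (p.2 : Module.End K M),
              (lefschetzLieAlgebra K h 𝔞).add_mem (h₁ p.1.2) (h₂ p.2.2)⟩
            map_add' := fun p q ↦ by
              apply Subtype.ext
              show ((p.1 : Module.End K M) + q.1) + ((p.2 : Module.End K M) + q.2) =
                ((p.1 : Module.End K M) + p.2) + ((q.1 : Module.End K M) + q.2)
              abel
            map_smul' := fun c p ↦ by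
              apply Subtype.ext
              show c • (p.1 : Module.End K M) + c • (p.2 : Module.End K M) =
                c • ((p.1 : Module.End K M) + (p.2 : Module.End K M))
              rw [smul_add]
            map_lie' := fun {p q} ↦ by
              apply Subtype.ext
              have hc : ⁅(p.1 : Module.End K M), (q.2 : Module.End K M)⁆ = 0 :=
                A.lie_eq_zero_of_mem_horizontal_of_mem_vertical hH𝔤 hH hHh p.1.2 q.2.2
              have hc' : ⁅(p.2 : Module.End K M), (q.1 : Module.End K M)⁆ = 0 := by
                rw [← lie_skew, A.lie_eq_zero_of_mem_horizontal_of_mem_vertical hH𝔤 hH hHh q.1.2 p.2.2, neg_zero]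
              show ((⁅p.1, q.1⁆ : lefschetzLieAlgebra K H (horizontalTwoZero H 𝔞)) : Module.End K M) +
                  ((⁅p.2, q.2⁆ : lefschetzLieAlgebra K (h - H) (verticalZeroTwo H 𝔞)) : Module.End K M) =
                ⁅(p.1 : Module.End K M) + p.2, (q.1 : Module.End K M) + q.2⁆
              rw [LieSubalgebra.coe_bracket, LieSubalgebra.coe_bracket, add_lie, lie_add, lie_add, hc, hc', add_zero,
                zero_add] }, ?_, fun p ↦ rfl⟩
  intro p q hpq
  have h0 : (p.1 : Module.End K M) + p.2 = (q.1 : Module.End K M) + q.2 := congrArg Subtype.val hpq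
  -- `p.1 - q.1 = q.2 - p.2 ∈ G₁ ∩ G₂ = 0`
  have hd := A.disjoint_horizontal_vertical hH𝔤 hH hHh hss
  rw [Submodule.disjoint_def] at hd
  have e1 : ((p.1 : Module.End K M) - q.1) = (q.2 : Module.End K M) - p.2 := by
    rw [sub_eq_sub_iff_add_eq_add, h0, add_comm]
  have hz := hd _ ((lefschetzLieAlgebra K H (horizontalTwoZero H 𝔞)).sub_mem p.1.2 q.1.2)
    (by rw [e1]; exact (lefschetzLieAlgebra K (h - H) (verticalZeroTwo H 𝔞)).sub_mem q.2.2 p.2.2)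
  have e2 : (q.2 : Module.End K M) - p.2 = 0 := by rw [← e1, hz]
  rw [sub_eq_zero] at hz e2
  exact Prod.ext (Subtype.ext hz) (Subtype.ext e2.symm)

/-- **The vertical Lefschetz module `(𝔞_{0,2}, M_ver)`**: under the printed hypothesis "`Gr^ver M` is a Lefschetz
module of `𝔞`" in the model (`Gr^ver M` identified with `M` graded by `h_ver = h - h_hor`, on which `𝔞_ver` acts by
`a ↦ a_0`, `apply_mem_verFiltration_of_mem_verticalPart`): some `a_0`, `a ∈ 𝔞_ver`, is a Lefschetz operator of
`(M, h_ver)` and `𝔤(𝔞_{0,2}, M_ver)` is semisimple ⟹ `(𝔞_{0,2}, M_ver)` is a Lefschetz module (A1-88) — "has the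
Lefschetz property in `M` with respect to the vertical grading … maps isomorphically onto `𝔤(𝔞, Gr^ver M)`".
[cite: LooijengaLunts1997, §5 (5.3) Proposition, p. 21 L45–L50] -/
theorem IsLefschetzModule.isLefschetzModule_verticalZeroTwo (A : IsLefschetzModule K h 𝔞) (hH : IsZGrading H)
    (hHh : H ∈ adDegree K h 0) (hW0 : h - H ≠ 0) {a : Module.End K M} (ha : a ∈ verticalPart H 𝔞)
    (hL : HasLefschetzProperty (h - H) (degreeComponent (LieAlgebra.ad K (Module.End K M) H) 0 a))
    (hss : LieAlgebra.IsSemisimple K (lefschetzLieAlgebra K (h - H) (verticalZeroTwo H 𝔞))) :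
    IsLefschetzModule K (h - H) (verticalZeroTwo H 𝔞) where
  isZGrading := isZGrading_sub_of_commute A.isZGrading hH (mul_comm_of_mem_adDegree_zero hHh)
  le_adDegree_two := verticalZeroTwo_le_adDegree_sub_two hH hHh A.le_adDegree_two
  lie_eq_zero := fun _ hx _ hy ↦ lie_eq_zero_of_mem_verticalZeroTwo hH A.lie_eq_zero hx hy
  nonempty_lefschetzDomain :=
    ⟨_, (mem_lefschetzDomain_iff_hasLefschetzProperty
      (isZGrading_sub_of_commute A.isZGrading hH (mul_comm_of_mem_adDegree_zero hHh)) hW0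
      (degreeComponent_mem_verticalZeroTwo ha)).2 hL⟩
  isSemisimple := hss

end LefschetzModule

end Literature.Algebra.Lie
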